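import Mathlib
import Summits.Ventures.HodgeRepro.Tier4.Common.TorusInfCompactConj
import Summits.Ventures.HodgeRepro.Tier4.Line4.TorusWeightLocal
import Summits.Ventures.HodgeRepro.Tier4.Line4.WeightCharacterSeesaw

/-!
# Tier4/Line4/WeightCharacterSeesawPrime — the wall's `_hchi'` BY CONSTRUCTION on the SEESAW PLANE
`(mixedRow q (a 0) (a 2)).withTransportedTorus g g' …` (= LINE L4's `seesawPlane`), the transported torus `T′`
(C-L4-B-EXTEND, part 3b; part 3a = `WeightCharacterSeesaw.lean`, the torus `T`)

Blind re-derivation cell `pub-hodge-repro`, Tier 4 «prove the step» (README §9–§10), seat t4-x2 (reserve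
wall-breaker, gen 6; GO S16576).  Tree path `lean/Summits/Ventures/HodgeRepro/Tier4/Line4/WeightCharacterSeesawPrime.lean`.
Imports: Mathlib + Common (`TorusInfCompactConj`: `compactSpace_infinitePart_subgroupOf_torusT'_seesaw`,
`torusT'_withTransportedTorus_conj`) + Line4 (`TorusWeightLocal`: `torusWeight'`, `torusWeight'_mul`,
`torusWeight'_one`, `torusWeight'_of_mem_localTorusAt'`, `norm_weightAt'_eq_one_of_mem_torusT'`,
`weightAt'_ne_zero_of_mem_torusT'`, `weightAt'_eq_weightAt_conjTo`, `continuous_conjTo`; `WeightCharacterSeesaw`: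
`rationalOf_inf_torusInf'_eq_bot`, `isClosed_rationalOf_torusT'`, `mem_infinitePart_of_mem_atPlace`,
`isGenuineRow_seesawPlane`, the generic extension `exists_continuousMonoidHom_extend_of_print` through it).  No
definition, no instance, no printed theorem proved.

WHAT.  The wall `mixed_two_torus` asks `chi' : T′(𝔸) → ℂ` with `chi'_mul`, `chi'_rational`, `hc'`, `_hunit'` and
`_hchi' : ∀ w, ChiMatchesAt' … g g' (eP' w) (eM' w) chi'`.  Here, on the seesaw plane:
* `torusT'_seesaw_mul_comm` — `T′(𝔸)` is commutative (`g′ T′ g` is the torus of the row plane `mixedRow q (a 1) (a 3)`,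
  typer-2's `torusT'_withTransportedTorus_conj`; RowTorus; conjugation is invertible on matrices);
* `continuous_weightAt'_seesaw`, `norm_torusWeight'_eq_one_seesaw`, `continuous_torusWeight'_seesaw`,
  `exists_weight_character'_seesaw` — L1-p5's `torusWeight' eP' eM'` is a continuous character `T′(𝔸) → 𝕋`;
* **`exists_wall_character'_ktypes_seesaw`** — the `T′` character: `chi' : T′(𝔸) → ℂ` multiplicative, trivial on
  `T′(k)`, continuous, of modulus one, with `∀ w, ChiMatchesAt' … g g' (eP' w) (eM' w) chi'`, from the integers
  `eP' eM'` alone, modulo the print [DE14] Cor. 3.6.2 on the compact `T′(k)\T′(𝔸)` (`hDE'`; the `CommGroup` in its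
  type is `torusT'_seesaw_mul_comm`, `T′(k)` closed by `isClosed_rationalOf_torusT'`, the compactness of the quotient by
  `compactSpace_quotient_of_cocompact` from `cocompact_rationalOf_torusT'_of_anisotropic`).
NOT here: the PAIR `(chi, chi')` with the centre condition `chi_centre` (N2) — the two characters are extended
INDEPENDENTLY (part 3a and here); their agreement on `Z(𝔸)` needs the joint extension — and the face's identity.
Nothing here says anything about the status of the Hodge conjecture for CM abelian varieties, which is NOT proved;
HC_CM is NOT proved by anyone in this repository.
-/

set_option autoImplicit false

noncomputable section

namespace Summit.Ventures.HodgeRepro.Tier4.Line4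

open NumberField Matrix Summit.Ventures.HodgeRepro.Tier4.Common Summit.Ventures.HodgeRepro.Tier4.Line1
  Summit.Ventures.HodgeRepro.Tier4.Lit

section SeesawPrime

variable {k : Type} [Field k] [NumberField k] (q : QuadData k) (a : Fin 4 → k)
  (g g' : Matrix (Fin 4) (Fin 4) k) (hgg' : g * g' = 1) (hg'g : g' * g = 1)
  (hgΩ : g * (PlaneData.mixedRow q (a 0) (a 2)).Ω = (PlaneData.mixedRow q (a 0) (a 2)).Ω * g)

/-! ### The transported torus `T′` of the seesaw plane -/

variable (lam : k) (hlam : lam ≠ 0)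
  (hiso : g * (PlaneData.mixedRow q (a 1) (a 3)).B * gᵀ = lam • (PlaneData.mixedRow q (a 0) (a 2)).B)

include lam hlam hiso in
/-- **`T′(𝔸)` of the seesaw plane is commutative**: `g′ T′ g` is the torus of the row plane `mixedRow q (a 1) (a 3)`
(typer-2 `torusT'_withTransportedTorus_conj`), which is commutative (RowTorus); `x ↦ g′ x g` is injective. -/
theorem torusT'_seesaw_mul_comm (ha1 : a 1 ≠ 0) (ha3 : a 3 ≠ 0)
    (x y : torusT' ((PlaneData.mixedRow q (a 0) (a 2)).withTransportedTorus g g' hgg' hg'g hgΩ)) : x * y = y * x := by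
  obtain ⟨x', hx'T, hx'⟩ := torusT'_withTransportedTorus_conj q a g g' hgg' hg'g hgΩ lam hlam hiso x.1 x.2
  obtain ⟨y', hy'T, hy'⟩ := torusT'_withTransportedTorus_conj q a g g' hgg' hg'g hgΩ lam hlam hiso y.1 y.2
  have hA : adMat k g * adMat k g' = 1 := Line4.adMat_mul_adMat_eq_one g g' hgg'
  have hA' : adMat k g' * adMat k g = 1 := Line4.adMat_mul_adMat_eq_one g' g hg'g
  have hcomm : x' * y' = y' * x' :=
    torusT_ofLinesRow_comm q (a 1) (a 3) (-1) ha1 ha3 (neg_ne_zero.2 one_ne_zero) x' y' hx'T hy'T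
  have hcommM : GA.mat (PlaneData.ofLinesRow q (a 1) (a 3) (-1)) x' * GA.mat (PlaneData.ofLinesRow q (a 1) (a 3) (-1)) y' =
      GA.mat (PlaneData.ofLinesRow q (a 1) (a 3) (-1)) y' * GA.mat (PlaneData.ofLinesRow q (a 1) (a 3) (-1)) x' := by
    rw [← GA.mat_mul, hcomm, GA.mat_mul]
  -- conjugation by `(g′, g)` is multiplicative and invertible on matrices
  have key : ∀ X Y : M4 k, (adMat k g' * X * adMat k g) * (adMat k g' * Y * adMat k g) =
      adMat k g' * (X * Y) * adMat k g := by
    intro X Y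
    simp only [Matrix.mul_assoc]
    rw [← Matrix.mul_assoc (adMat k g) (adMat k g'), hA, Matrix.one_mul]
  have key2 : ∀ M : M4 k, adMat k g * (adMat k g' * M * adMat k g) * adMat k g' = M := by
    intro M
    simp only [Matrix.mul_assoc]
    rw [hA, Matrix.mul_one, ← Matrix.mul_assoc, hA, Matrix.one_mul]
  -- `g′ (x y) g = x' y' = y' x' = g′ (y x) g`
  have hxy : adMat k g' * (GA.mat _ x.1 * GA.mat _ y.1) * adMat k g =
      adMat k g' * (GA.mat _ y.1 * GA.mat _ x.1) * adMat k g := by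
    rw [← key, ← key, ← hx', ← hy', hcommM]
  have hmat : GA.mat _ (x.1 * y.1) = GA.mat _ (y.1 * x.1) := by
    rw [GA.mat_mul, GA.mat_mul]
    calc GA.mat _ x.1 * GA.mat _ y.1
        = adMat k g * (adMat k g' * (GA.mat _ x.1 * GA.mat _ y.1) * adMat k g) * adMat k g' := (key2 _).symm
      _ = adMat k g * (adMat k g' * (GA.mat _ y.1 * GA.mat _ x.1) * adMat k g) * adMat k g' := by rw [hxy]
      _ = GA.mat _ y.1 * GA.mat _ x.1 := key2 _
  apply Subtype.ext
  apply Subtype.ext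
  apply Units.ext
  exact hmat

include lam hiso in
/-- `weightAt' … j` is continuous on `G(𝔸)` (the weight of the conjugate, `conjTo` continuous). -/
theorem continuous_weightAt'_seesaw (w : InfinitePlace k) (j : Fin 2) :
    Continuous fun κ : GA ((PlaneData.mixedRow q (a 0) (a 2)).withTransportedTorus g g' hgg' hg'g hgΩ) =>
      weightAt' ((PlaneData.mixedRow q (a 0) (a 2)).withTransportedTorus g g' hgg' hg'g hgΩ) q w g g' j κ := by
  have h : (fun κ : GA ((PlaneData.mixedRow q (a 0) (a 2)).withTransportedTorus g g' hgg' hg'g hgΩ) =>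
      weightAt' ((PlaneData.mixedRow q (a 0) (a 2)).withTransportedTorus g g' hgg' hg'g hgΩ) q w g g' j κ) =
      fun κ => weightAt (PlaneData.ofLinesRow q (a 1) (a 3) (-1)) q w j (conjTo q a g g' hgg' hg'g hgΩ lam hiso κ) :=
    funext fun κ => weightAt'_eq_weightAt_conjTo q a g g' hgg' hg'g hgΩ lam hiso w κ j
  rw [h]
  exact (continuous_weightAt q w _ j).comp (continuous_conjTo q a g g' hgg' hg'g hgΩ lam hiso)

include lam hlam hiso in
/-- `‖torusWeight' eP′ eM′ κ‖ = 1` on `T′(𝔸)`. -/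
theorem norm_torusWeight'_eq_one_seesaw (ha1 : a 1 ≠ 0) (ha3 : a 3 ≠ 0) (hreal : ∀ w : InfinitePlace k, w.IsReal)
    (hcm : ∀ w, IsCMAt q w) (eP' eM' : InfinitePlace k → ℤ)
    (κ : torusT' ((PlaneData.mixedRow q (a 0) (a 2)).withTransportedTorus g g' hgg' hg'g hgΩ)) :
    ‖torusWeight' q a g g' hgg' hg'g hgΩ eP' eM' κ.1‖ = 1 := by
  unfold torusWeight'
  rw [norm_prod]
  refine Finset.prod_eq_one fun w _ => ?_
  rw [norm_mul, norm_zpow, norm_zpow,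
    norm_weightAt'_eq_one_of_mem_torusT' q a g g' hgg' hg'g hgΩ lam hlam hiso w (hreal w) (hcm w) ha1 ha3 0 κ.2,
    norm_weightAt'_eq_one_of_mem_torusT' q a g g' hgg' hg'g hgΩ lam hlam hiso w (hreal w) (hcm w) ha1 ha3 1 κ.2,
    _root_.one_zpow, _root_.one_zpow, mul_one]

include lam hlam hiso in
/-- `torusWeight' eP′ eM′` is continuous on `T′(𝔸)`. -/
theorem continuous_torusWeight'_seesaw (ha1 : a 1 ≠ 0) (ha3 : a 3 ≠ 0) (hreal : ∀ w : InfinitePlace k, w.IsReal)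
    (hcm : ∀ w, IsCMAt q w) (eP' eM' : InfinitePlace k → ℤ) :
    Continuous fun κ : torusT' ((PlaneData.mixedRow q (a 0) (a 2)).withTransportedTorus g g' hgg' hg'g hgΩ) =>
      torusWeight' q a g g' hgg' hg'g hgΩ eP' eM' κ.1 := by
  unfold torusWeight'
  refine continuous_finsetProd _ fun w _ => Continuous.mul ?_ ?_
  · exact ((continuous_weightAt'_seesaw q a g g' hgg' hg'g hgΩ lam hiso w 0).comp continuous_subtype_val).zpow₀ _
      (fun κ => Or.inl (weightAt'_ne_zero_of_mem_torusT' q a g g' hgg' hg'g hgΩ lam hlam hiso w (hreal w) (hcm w)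
        ha1 ha3 0 κ.2))
  · exact ((continuous_weightAt'_seesaw q a g g' hgg' hg'g hgΩ lam hiso w 1).comp continuous_subtype_val).zpow₀ _
      (fun κ => Or.inl (weightAt'_ne_zero_of_mem_torusT' q a g g' hgg' hg'g hgΩ lam hlam hiso w (hreal w) (hcm w)
        ha1 ha3 1 κ.2))

include lam hlam hiso in
/-- **The archimedean weight character of `T′` with prescribed `K`-type integers**: L1-p5's `torusWeight' eP′ eM′`
(`∏_w weightAt' … w 0 κ ^ (−eP′ w) · weightAt' … w 1 κ ^ (−eM′ w)`) is a continuous character `T′(𝔸) → 𝕋`. -/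
theorem exists_weight_character'_seesaw (ha1 : a 1 ≠ 0) (ha3 : a 3 ≠ 0)
    (hreal : ∀ w : InfinitePlace k, w.IsReal) (hcm : ∀ w, IsCMAt q w) (eP' eM' : InfinitePlace k → ℤ) :
    ∃ ψ : ContinuousMonoidHom (torusT' ((PlaneData.mixedRow q (a 0) (a 2)).withTransportedTorus g g' hgg' hg'g hgΩ))
      Circle, ∀ κ : torusT' ((PlaneData.mixedRow q (a 0) (a 2)).withTransportedTorus g g' hgg' hg'g hgΩ),
        ((ψ κ : Circle) : ℂ) = torusWeight' q a g g' hgg' hg'g hgΩ eP' eM' κ.1 := by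
  have hall : ∀ w : InfinitePlace k, w.IsReal ∧ IsCMAt q w := fun w => ⟨hreal w, hcm w⟩
  have hF_mem : ∀ κ : torusT' ((PlaneData.mixedRow q (a 0) (a 2)).withTransportedTorus g g' hgg' hg'g hgΩ),
      torusWeight' q a g g' hgg' hg'g hgΩ eP' eM' κ.1 ∈ Submonoid.unitSphere ℂ :=
    fun κ => mem_sphere_zero_iff_norm.mpr
      (norm_torusWeight'_eq_one_seesaw q a g g' hgg' hg'g hgΩ lam hlam hiso ha1 ha3 hreal hcm eP' eM' κ)
  refine ⟨{ toFun := fun κ => ⟨torusWeight' q a g g' hgg' hg'g hgΩ eP' eM' κ.1, hF_mem κ⟩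
            map_one' := Subtype.ext (torusWeight'_one q a g g' hgg' hg'g hgΩ lam hiso eP' eM')
            map_mul' := fun κ κ' => Subtype.ext
              (torusWeight'_mul q a g g' hgg' hg'g hgΩ lam hlam hiso hall ha1 ha3 eP' eM' κ.2 κ'.2)
            continuous_toFun := Continuous.subtype_mk
              (continuous_torusWeight'_seesaw q a g g' hgg' hg'g hgΩ lam hlam hiso ha1 ha3 hreal hcm eP' eM') _ },
    fun κ => rfl⟩

include lam hlam hiso in
/-- **THE WALL'S `chi'` WITH `_hchi'` ON THE SEESAW PLANE, modulo the print**: for any integers `eP' eM'`, a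
`chi' : T′(𝔸) → ℂ`, multiplicative, trivial on `T′(k)`, continuous, of modulus one, with
`ChiMatchesAt' … g g' (eP' w) (eM' w) chi'` at every infinite place — the wall's `chi'`, `chi'_mul`, `chi'_rational`,
`hc'`, `_hunit'`, `_hchi'`.  Inputs: the seesaw plane's data, `hA` (cocompactness of `T′(k)`, TorusCocompactAniso),
`hDE'` = the print [DE14] Cor. 3.6.2 on the compact quotient `T′(k)\T′(𝔸)` (the `CommGroup` in its type is
`torusT'_seesaw_mul_comm`; `T′(k)` closed by `isClosed_rationalOf_torusT'`; the compactness of the quotient is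
`compactSpace_quotient_of_cocompact`). -/
theorem exists_wall_character'_ktypes_seesaw (ht : q.t = 0) (hn : ¬ IsSquare (-q.n)) (ha : ∀ i, a i ≠ 0)
    (hreal : ∀ w : InfinitePlace k, w.IsReal) (hcm : ∀ w, IsCMAt q w)
    (hA : IsAnisotropic ((PlaneData.mixedRow q (a 0) (a 2)).withTransportedTorus g g' hgg' hg'g hgΩ))
    (hDE' : letI : CommGroup (torusT' ((PlaneData.mixedRow q (a 0) (a 2)).withTransportedTorus g g' hgg' hg'g hgΩ)) :=
        { (inferInstance : Group (torusT' ((PlaneData.mixedRow q (a 0) (a 2)).withTransportedTorus g g' hgg' hg'g hgΩ)))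
          with mul_comm := torusT'_seesaw_mul_comm q a g g' hgg' hg'g hgΩ lam hlam hiso (ha 1) (ha 3) }
      haveI : IsClosed ((rationalOf ((PlaneData.mixedRow q (a 0) (a 2)).withTransportedTorus g g' hgg' hg'g hgΩ)
          (torusT' ((PlaneData.mixedRow q (a 0) (a 2)).withTransportedTorus g g' hgg' hg'g hgΩ)) :
          Subgroup (torusT' ((PlaneData.mixedRow q (a 0) (a 2)).withTransportedTorus g g' hgg' hg'g hgΩ))) :
          Set (torusT' ((PlaneData.mixedRow q (a 0) (a 2)).withTransportedTorus g g' hgg' hg'g hgΩ))) :=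
        isClosed_rationalOf_torusT' _
      haveI : CompactSpace (torusT' ((PlaneData.mixedRow q (a 0) (a 2)).withTransportedTorus g g' hgg' hg'g hgΩ) ⧸
          rationalOf ((PlaneData.mixedRow q (a 0) (a 2)).withTransportedTorus g g' hgg' hg'g hgΩ)
            (torusT' ((PlaneData.mixedRow q (a 0) (a 2)).withTransportedTorus g g' hgg' hg'g hgΩ))) :=
        compactSpace_quotient_of_cocompact _ (cocompact_rationalOf_torusT'_of_anisotropic _
          (isGenuineRow_seesawPlane q ht hn a (ha 0) (ha 2) g g' hgg' hg'g hgΩ lam hlam hiso) hA)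
      DeitmarEchterhoff2014_Cor_3_6_2_restriction_surjective
        (torusT' ((PlaneData.mixedRow q (a 0) (a 2)).withTransportedTorus g g' hgg' hg'g hgΩ) ⧸
          rationalOf ((PlaneData.mixedRow q (a 0) (a 2)).withTransportedTorus g g' hgg' hg'g hgΩ)
            (torusT' ((PlaneData.mixedRow q (a 0) (a 2)).withTransportedTorus g g' hgg' hg'g hgΩ))))
    (eP' eM' : InfinitePlace k → ℤ) :
    ∃ chi' : torusT' ((PlaneData.mixedRow q (a 0) (a 2)).withTransportedTorus g g' hgg' hg'g hgΩ) → ℂ,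
      (∀ s t, chi' (s * t) = chi' s * chi' t) ∧
      (∀ t ∈ rationalOf ((PlaneData.mixedRow q (a 0) (a 2)).withTransportedTorus g g' hgg' hg'g hgΩ)
        (torusT' ((PlaneData.mixedRow q (a 0) (a 2)).withTransportedTorus g g' hgg' hg'g hgΩ)), chi' t = 1) ∧
      Continuous chi' ∧ (∀ t, ‖chi' t‖ = 1) ∧
      ∀ w : InfinitePlace k, ChiMatchesAt' ((PlaneData.mixedRow q (a 0) (a 2)).withTransportedTorus g g' hgg' hg'g hgΩ)
        q w g g' (eP' w) (eM' w) chi' := by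
  letI : CommGroup (torusT' ((PlaneData.mixedRow q (a 0) (a 2)).withTransportedTorus g g' hgg' hg'g hgΩ)) :=
    { (inferInstance : Group (torusT' ((PlaneData.mixedRow q (a 0) (a 2)).withTransportedTorus g g' hgg' hg'g hgΩ)))
      with mul_comm := torusT'_seesaw_mul_comm q a g g' hgg' hg'g hgΩ lam hlam hiso (ha 1) (ha 3) }
  haveI : IsClosed ((rationalOf ((PlaneData.mixedRow q (a 0) (a 2)).withTransportedTorus g g' hgg' hg'g hgΩ)
      (torusT' ((PlaneData.mixedRow q (a 0) (a 2)).withTransportedTorus g g' hgg' hg'g hgΩ)) :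
      Subgroup (torusT' ((PlaneData.mixedRow q (a 0) (a 2)).withTransportedTorus g g' hgg' hg'g hgΩ))) :
      Set (torusT' ((PlaneData.mixedRow q (a 0) (a 2)).withTransportedTorus g g' hgg' hg'g hgΩ))) :=
    isClosed_rationalOf_torusT' _
  haveI : CompactSpace (torusT' ((PlaneData.mixedRow q (a 0) (a 2)).withTransportedTorus g g' hgg' hg'g hgΩ) ⧸
      rationalOf ((PlaneData.mixedRow q (a 0) (a 2)).withTransportedTorus g g' hgg' hg'g hgΩ)
        (torusT' ((PlaneData.mixedRow q (a 0) (a 2)).withTransportedTorus g g' hgg' hg'g hgΩ))) :=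
    compactSpace_quotient_of_cocompact _ (cocompact_rationalOf_torusT'_of_anisotropic _
      (isGenuineRow_seesawPlane q ht hn a (ha 0) (ha 2) g g' hgg' hg'g hgΩ lam hlam hiso) hA)
  haveI : CompactSpace (torusInf' ((PlaneData.mixedRow q (a 0) (a 2)).withTransportedTorus g g' hgg' hg'g hgΩ)) :=
    compactSpace_infinitePart_subgroupOf_torusT'_seesaw q a g g' hgg' hg'g hgΩ lam hlam hiso (ha 1) (ha 3) hreal hcm
  obtain ⟨ψ, hψ⟩ :=
    exists_weight_character'_seesaw q a g g' hgg' hg'g hgΩ lam hlam hiso (ha 1) (ha 3) hreal hcm eP' eM'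
  let ι : ContinuousMonoidHom (torusInf' ((PlaneData.mixedRow q (a 0) (a 2)).withTransportedTorus g g' hgg' hg'g hgΩ))
      (torusT' ((PlaneData.mixedRow q (a 0) (a 2)).withTransportedTorus g g' hgg' hg'g hgΩ)) :=
    { (torusInf' ((PlaneData.mixedRow q (a 0) (a 2)).withTransportedTorus g g' hgg' hg'g hgΩ)).subtype with
      continuous_toFun := continuous_subtype_val }
  let ψ' : ContinuousMonoidHom (torusInf' ((PlaneData.mixedRow q (a 0) (a 2)).withTransportedTorus g g' hgg' hg'g hgΩ))
      Circle := ψ.comp ι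
  obtain ⟨χ, hΓ, hK⟩ := exists_continuousMonoidHom_extend_of_print
    (rationalOf ((PlaneData.mixedRow q (a 0) (a 2)).withTransportedTorus g g' hgg' hg'g hgΩ)
      (torusT' ((PlaneData.mixedRow q (a 0) (a 2)).withTransportedTorus g g' hgg' hg'g hgΩ)))
    (torusInf' ((PlaneData.mixedRow q (a 0) (a 2)).withTransportedTorus g g' hgg' hg'g hgΩ))
    (isCompact_iff_compactSpace.mpr ‹_›) (rationalOf_inf_torusInf'_eq_bot _) hDE' ψ'
  refine ⟨fun t => ((χ t : Circle) : ℂ), fun s t => ?_, fun t ht => ?_, ?_, fun t => Circle.norm_coe _,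
    fun w κ hκ => ?_⟩
  · show ((χ (s * t) : Circle) : ℂ) = ((χ s : Circle) : ℂ) * ((χ t : Circle) : ℂ)
    rw [map_mul, Circle.coe_mul]
  · show ((χ t : Circle) : ℂ) = 1
    rw [hΓ t ht, Circle.coe_one]
  · exact continuous_subtype_val.comp χ.continuous
  · -- `κ ∈ T′_w ⊆ T′_∞`: the extension takes the value of the weight character, the `w`-monomial
    have hκinf : κ ∈ torusInf' ((PlaneData.mixedRow q (a 0) (a 2)).withTransportedTorus g g' hgg' hg'g hgΩ) := by
      rw [torusInf', Subgroup.mem_subgroupOf]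
      exact mem_infinitePart_of_mem_atPlace _ hκ.2
    have h1 : ((χ κ : Circle) : ℂ) = ((ψ κ : Circle) : ℂ) :=
      congrArg (fun z : Circle => (z : ℂ)) (hK ⟨κ, hκinf⟩)
    show ((χ κ : Circle) : ℂ) * _ * _ = 1
    rw [h1, hψ κ, torusWeight'_of_mem_localTorusAt' q a g g' hgg' hg'g hgΩ lam hlam hiso eP' eM' hκ]
    have hA0 : weightAt' ((PlaneData.mixedRow q (a 0) (a 2)).withTransportedTorus g g' hgg' hg'g hgΩ) q w g g' 0
        κ.1 ^ (eP' w) ≠ 0 :=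
      zpow_ne_zero _ (weightAt'_ne_zero_of_mem_torusT' q a g g' hgg' hg'g hgΩ lam hlam hiso w (hreal w) (hcm w)
        (ha 1) (ha 3) 0 κ.2)
    have hB0 : weightAt' ((PlaneData.mixedRow q (a 0) (a 2)).withTransportedTorus g g' hgg' hg'g hgΩ) q w g g' 1
        κ.1 ^ (eM' w) ≠ 0 :=
      zpow_ne_zero _ (weightAt'_ne_zero_of_mem_torusT' q a g g' hgg' hg'g hgΩ lam hlam hiso w (hreal w) (hcm w)
        (ha 1) (ha 3) 1 κ.2)
    rw [_root_.zpow_neg, _root_.zpow_neg]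
    field_simp

end SeesawPrime

end Summit.Ventures.HodgeRepro.Tier4.Line4

end
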